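import Mathlib
import HarnessLib
import Literature.Analysis.FluidPDE.VectorCalculus
import Literature.Analysis.FluidPDE.VorticityCalculus
import Literature.Analysis.FluidPDE.TaoEnstrophyLocalisationProofs
import Literature.Analysis.FluidPDE.CurlFreeLiouville
import Literature.Analysis.FluidPDE.LocalTypeI
import Summits.NavierStokesRegularity.NavierStokesRegularity.Theorems.LocalSineTubeDoorProfileAlignedWindowRigidity

/-!
# Route `PoloidalWindowDoor` (staged, nsreg-p1), crux `PoloidalWindowRigidity` — stub `stub_flatStratum`
# (the FLAT sub-stratum of the poloidal stratum is empty)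

Cell ns-regularity-ideate, seat p6 (route-directed support; land `--supports <PoloidalWindowRigidity item>` once
the route is born — the statement is VERBATIM the registered stub signature, tree vocabulary only).  Port of the
cell's kernel theorems of nsreg-p1 ROUND-8 (Sketch8A (R8-d): `fderiv_apply_eq_of_flat_poloidal`,
`sliceInvariant_of_flat_poloidal`, `poloidalRigidity_rung_flat`): a profile of the route's class which is
poloidal along `e₃` (`⟪curl v(s), e₃⟫ ≡ 0`) and whose third velocity component does not vary in ONE horizontal
direction (`∂₀ v₂ ≡ 0`) is not backward-singular — in fact `v ≡ 0`: plane-wise constancy of `∂₀v(s)` by the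
tree's curl-free/div-free Liouville theorem `eq_of_curl_eq_zero_of_isDivFree_of_bounded` (gradient bound (D)
`Theorems.LocalSineTubeDoorProfileAlignedWindowRigidityAncient.exists_fderiv_slice_bound`), boundedness along the
lines `y + l e₀` ⇒ every slice is invariant along `e₀`, and the Type-I planar Liouville theorem (N₁)
`Theorems.LocalSineTubeDoorProfileAlignedWindowRigidity.eq_zero_of_translate_eq` concludes.

WHAT THIS IS NOT: not a claim about Navier–Stokes regularity; a support lemma for a STAGED door route.
-/

noncomputable section

-- the summit and its single sub-problem share the name (CONVENTIONS §1), as in every Theorems file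
set_option linter.dupNamespace false

namespace Summit.NavierStokesRegularity.NavierStokesRegularity.Theorems.PoloidalWindowDoorPoloidalWindowRigidityFlat

open MeasureTheory Set Function Filter Topology TopologicalSpace Metric
open scoped RealInnerProductSpace InnerProductSpace ENNReal
open Literature.Analysis Literature.Analysis.FluidPDE
open Summit.NavierStokesRegularity.NavierStokesRegularity.Theorems.LocalSineTubeDoorProfileAlignedWindowRigidityAncient
open Summit.NavierStokesRegularity.NavierStokesRegularity.Theorems.LocalSineTubeDoorProfileAlignedWindowRigidity

/-- Components commute with the derivative: `(DF(z) k)ᵢ = D(Fᵢ)(z) k`. -/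
theorem fderiv_apply_coord {F : (EuclideanSpace ℝ (Fin 3)) → (EuclideanSpace ℝ (Fin 3))} {z : (EuclideanSpace ℝ (Fin 3))} (hF : DifferentiableAt ℝ F z) (k : (EuclideanSpace ℝ (Fin 3)))
    (i : Fin 3) : fderiv ℝ F z k i = fderiv ℝ (fun w => F w i) z k := by
  have h : (fun w => F w i) = (EuclideanSpace.proj (𝕜 := ℝ) i : (EuclideanSpace ℝ (Fin 3)) →L[ℝ] ℝ) ∘ F := rfl
  rw [h, ((EuclideanSpace.proj (𝕜 := ℝ) i : (EuclideanSpace ℝ (Fin 3)) →L[ℝ] ℝ).hasFDerivAt.comp z hF.hasFDerivAt).fderiv]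
  rfl


/-- A profile vanishing on the open backward slab is not backward-singular at the apex. -/
theorem not_backwardSingular_of_zero {v : ℝ → (EuclideanSpace ℝ (Fin 3)) → (EuclideanSpace ℝ (Fin 3))} (hzero : ∀ t < 0, ∀ y, v t y = 0) :
    ¬ IsBackwardSingularPoint v 0 := by
  intro hsing
  have h1 := hsing 1 one_pos
  have hmeas : MeasurableSet (parabolicCylinder 1 (0 : ℝ × (EuclideanSpace ℝ (Fin 3)))) :=
    show MeasurableSet (Ioo _ _ ×ˢ ball _ _) from measurableSet_Ioo.prod measurableSet_ball
  have hle : eLpNorm (uncurry v) ∞ (volume.restrict (parabolicCylinder 1 (0 : ℝ × (EuclideanSpace ℝ (Fin 3))))) ≤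
      ENNReal.ofReal 0 := by
    rw [eLpNorm_exponent_top]
    refine eLpNormEssSup_le_of_ae_bound ((ae_restrict_iff' hmeas).2 (Eventually.of_forall ?_))
    intro z hz
    have hz' : z ∈ Ioo ((0 : ℝ × (EuclideanSpace ℝ (Fin 3))).1 - 1 ^ 2) (0 : ℝ × (EuclideanSpace ℝ (Fin 3))).1 ×ˢ ball (0 : ℝ × (EuclideanSpace ℝ (Fin 3))).2 1 := hz
    have hz0 : z.1 < 0 := by simpa using (mem_prod.1 hz').1.2
    show ‖v z.1 z.2‖ ≤ 0
    rw [hzero z.1 hz0 z.2, norm_zero]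
  exact absurd h1 (hle.trans_lt ENNReal.ofReal_lt_top).ne

/-- **Plane-wise constancy of `∂₀V`.** For `V ∈ C³` divergence-free with bounded gradient,
`(curl V)₂ ≡ 0` and `(∂₀V)₂ ≡ 0`, the field `W = ∂₀V` is constant on every horizontal plane
`{w₂ = c}`: its vertical-translation-invariant extension off the plane is curl-free (`ω₂ = 0`,
`W₂ = 0`), divergence-free (`div W = 0`, `∂₂W₂ = 0`) and bounded, hence constant (tree Liouville
`eq_of_curl_eq_zero_of_isDivFree_of_bounded`). -/
theorem fderiv_apply_eq_of_flat_poloidal {V : (EuclideanSpace ℝ (Fin 3)) → (EuclideanSpace ℝ (Fin 3))} (hV : ContDiff ℝ 3 V)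
    (hdiv : VectorCalculus.IsDivFree V) {M' : ℝ} (hM' : ∀ y, ‖fderiv ℝ V y‖ ≤ M')
    (hω : ∀ y, curl V y 2 = 0)
    (hfl : ∀ y, fderiv ℝ V y (EuclideanSpace.single 0 1) 2 = 0) {z z' : (EuclideanSpace ℝ (Fin 3))} (hzz' : z 2 = z' 2) :
    fderiv ℝ V z (EuclideanSpace.single 0 1) = fderiv ℝ V z' (EuclideanSpace.single 0 1) := by
  have hV2 : ContDiff ℝ 2 V := hV.of_le (by norm_num)
  -- the field `W = ∂₀V`
  have hW2 : ContDiff ℝ 2 (fun w => fderiv ℝ V w (EuclideanSpace.single 0 1)) :=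
    (hV.fderiv_right (m := 2) (by norm_cast)).clm_apply contDiff_const
  have hcurlW : ∀ w, curl (fun w => fderiv ℝ V w (EuclideanSpace.single 0 1)) w =
      fderiv ℝ (curl V) w (EuclideanSpace.single 0 1) := fun w => curl_fderiv_apply hV2 w _
  have hdivW : VectorCalculus.IsDivFree (fun w => fderiv ℝ V w (EuclideanSpace.single 0 1)) :=
    hdiv.fderiv_apply hV2 _
  set W : (EuclideanSpace ℝ (Fin 3)) → (EuclideanSpace ℝ (Fin 3)) := fun w => fderiv ℝ V w (EuclideanSpace.single 0 1) with hW
  have hW1 : Differentiable ℝ W := hW2.differentiable (by norm_num)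
  have hcurlV1 : Differentiable ℝ (curl V) :=
    (contDiff_curl (n := 2) (by exact_mod_cast hV)).differentiable (by norm_num)
  -- `W₂ ≡ 0`, hence `(DW k)₂ = 0`
  have hW₂ : ∀ w k, fderiv ℝ W w k 2 = 0 := fun w k => by
    rw [fderiv_apply_coord (hW1 w) k 2]
    have : (fun w => W w 2) = fun _ => (0 : ℝ) := funext fun w => hfl w
    rw [this]
    simp
  -- `(curl W)₂ = ∂₀ ω₂ = 0`, i.e. `(DW e₀)₁ = (DW e₁)₀`
  have hcW : ∀ w, fderiv ℝ W w (EuclideanSpace.single 0 1) 1 =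
      fderiv ℝ W w (EuclideanSpace.single 1 1) 0 := fun w => by
    have h3 : curl W w 2 = 0 := by
      rw [hcurlW w, fderiv_apply_coord (hcurlV1 w) _ 2]
      have : (fun w => curl V w 2) = fun _ => (0 : ℝ) := funext fun w => hω w
      rw [this]
      simp
    simp only [curl, PiLp.toLp_apply, Matrix.cons_val_two, Matrix.tail_cons, Matrix.head_cons] at h3
    linarith
  -- the plane `{w₂ = c}` through `z`, the vertical projection `E` onto it (linear part `P`), `G = W ∘ E`
  set c : ℝ := z 2 with hc
  set E : (EuclideanSpace ℝ (Fin 3)) → (EuclideanSpace ℝ (Fin 3)) := fun w => w + (c - w 2) • EuclideanSpace.single 2 1 with hE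
  set P : (EuclideanSpace ℝ (Fin 3)) →L[ℝ] (EuclideanSpace ℝ (Fin 3)) := ContinuousLinearMap.id ℝ (EuclideanSpace ℝ (Fin 3)) +
      ((0 : (EuclideanSpace ℝ (Fin 3)) →L[ℝ] ℝ) - EuclideanSpace.proj (𝕜 := ℝ) (2 : Fin 3)).smulRight
        (EuclideanSpace.single 2 1) with hP
  have hEd : ∀ w, HasFDerivAt E P w := fun w =>
    (hasFDerivAt_id w).add (((hasFDerivAt_const c w).sub
      ((EuclideanSpace.proj (𝕜 := ℝ) (2 : Fin 3) : (EuclideanSpace ℝ (Fin 3)) →L[ℝ] ℝ).hasFDerivAt)).smul_const _)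
  have hEs : ContDiff ℝ 2 E :=
    contDiff_id.add ((contDiff_const.sub
      ((EuclideanSpace.proj (𝕜 := ℝ) (2 : Fin 3) : (EuclideanSpace ℝ (Fin 3)) →L[ℝ] ℝ).contDiff)).smul contDiff_const)
  have hPa : P (EuclideanSpace.single 0 1) = EuclideanSpace.single 0 1 := by
    ext i; fin_cases i <;> simp [hP]
  have hPb : P (EuclideanSpace.single 1 1) = EuclideanSpace.single 1 1 := by
    ext i; fin_cases i <;> simp [hP]
  have hPe : P (EuclideanSpace.single 2 1) = 0 := by
    ext i; fin_cases i <;> simp [hP]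
  set G : (EuclideanSpace ℝ (Fin 3)) → (EuclideanSpace ℝ (Fin 3)) := fun w => W (E w) with hG
  have hG2 : ContDiff ℝ 2 G := hW2.comp hEs
  have hGd : ∀ w, HasFDerivAt G ((fderiv ℝ W (E w)).comp P) w := fun w =>
    (hW1 (E w)).hasFDerivAt.comp w (hEd w)
  have hGD : ∀ w k, fderiv ℝ G w k = fderiv ℝ W (E w) (P k) := fun w k => by
    rw [(hGd w).fderiv]; rfl
  -- `curl G = 0`
  have hcurlG : ∀ w, curl G w = 0 := fun w => by
    ext i
    fin_cases i <;> simp [curl, hGD, hPa, hPb, hPe, hW₂, hcW]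
  -- `div G = 0`
  have hdivG : VectorCalculus.IsDivFree G := fun w => by
    have hdW := hdivW (E w)
    rw [divergence_eq_sum_inner_fderiv (EuclideanSpace.basisFun (Fin 3) ℝ)] at hdW ⊢
    simp only [Fin.sum_univ_three, EuclideanSpace.basisFun_apply, hGD, hPa, hPb, hPe, map_zero,
      inner_zero_right, add_zero] at hdW ⊢
    have h22 : ⟪(EuclideanSpace.single 2 1 : (EuclideanSpace ℝ (Fin 3))),
        fderiv ℝ W (E w) (EuclideanSpace.single 2 1)⟫_ℝ = 0 := by
      rw [EuclideanSpace.inner_single_left]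
      simp [hW₂]
    linarith
  -- `G` bounded
  have hGb : ∀ w, ‖G w‖ ≤ M' * ‖(EuclideanSpace.single 0 1 : (EuclideanSpace ℝ (Fin 3)))‖ := fun w =>
    ((fderiv ℝ V (E w)).le_opNorm _).trans
      (mul_le_mul_of_nonneg_right (hM' (E w)) (norm_nonneg _))
  -- hence `G` is constant; evaluate at `z`, `z'` (both on the plane)
  have hGc := eq_of_curl_eq_zero_of_isDivFree_of_bounded hG2 hcurlG hdivG hGb z z'
  have hEz : E z = z := by simp [hE, hc]
  have hEz' : E z' = z' := by simp [hE, hzz']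
  simp only [hG, hEz, hEz'] at hGc
  exact hGc

/-- **The vector-calculus core of (R8-d).** `V ∈ C³` bounded with bounded gradient,
divergence-free, `(curl V)₂ ≡ 0` and `∂₀V₂ ≡ 0` ⟹ `V` is invariant along `e₀` (plane-wise
constancy of `∂₀V` + boundedness of `V` along the lines `y + l e₀`). -/
theorem translate_eq_of_flat_poloidal {V : (EuclideanSpace ℝ (Fin 3)) → (EuclideanSpace ℝ (Fin 3))} (hV : ContDiff ℝ 3 V)
    (hdiv : VectorCalculus.IsDivFree V) {M : ℝ} (hM : ∀ y, ‖V y‖ ≤ M) {M' : ℝ}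
    (hM' : ∀ y, ‖fderiv ℝ V y‖ ≤ M') (hω : ∀ y, curl V y 2 = 0)
    (hfl : ∀ y, fderiv ℝ V y (EuclideanSpace.single 0 1) 2 = 0) (y : (EuclideanSpace ℝ (Fin 3))) (l : ℝ) :
    V (y + l • (EuclideanSpace.single 0 1 : (EuclideanSpace ℝ (Fin 3)))) = V y := by
  have hV1 : Differentiable ℝ V := hV.differentiable (by norm_num)
  obtain ⟨e₀, he₀⟩ : ∃ e₀ : (EuclideanSpace ℝ (Fin 3)), EuclideanSpace.single 0 1 = e₀ := ⟨_, rfl⟩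
  obtain ⟨c, hc⟩ : ∃ c : (EuclideanSpace ℝ (Fin 3)), fderiv ℝ V y e₀ = c := ⟨_, rfl⟩
  have hconst : ∀ l : ℝ, fderiv ℝ V (y + l • e₀) e₀ = c := fun l => by
    rw [← hc, ← he₀]
    exact fderiv_apply_eq_of_flat_poloidal hV hdiv hM' hω hfl (by simp)
  rw [he₀]
  -- the line map `l ↦ V (y + l e₀)` has derivative `c`
  have hgd : ∀ l, HasDerivAt (fun l : ℝ => V (y + l • e₀)) c l := fun l => by
    have hline : HasDerivAt (fun l : ℝ => y + l • e₀) e₀ l := by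
      simpa using ((hasDerivAt_id l).smul_const e₀).const_add y
    have h := (hV1 (y + l • e₀)).hasFDerivAt.comp_hasDerivAt l hline
    rw [hconst l] at h
    exact h
  -- hence `V (y + l e₀) − l • c` is constant
  have hd : ∀ l, HasDerivAt (fun l : ℝ => V (y + l • e₀) - l • c) 0 l := fun l => by
    have h := (hgd l).sub ((hasDerivAt_id' l).smul_const c)
    simp only [one_smul, sub_self] at h
    exact h
  have hh : ∀ l, V (y + l • e₀) - l • c = V (y + (0 : ℝ) • e₀) - (0 : ℝ) • c := fun l =>
    is_const_of_deriv_eq_zero (f := fun l : ℝ => V (y + l • e₀) - l • c)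
      (fun l => (hd l).differentiableAt) (fun l => (hd l).deriv) l 0
  have hlin : ∀ l, V (y + l • e₀) = V y + l • c := fun l => by
    have := hh l
    simp only [zero_smul, sub_zero, add_zero] at this
    rw [← this]; abel
  -- boundedness of `V` forces `c = 0`
  have hc0 : c = 0 := by
    by_contra hne
    have hcpos : 0 < ‖c‖ := norm_pos_iff.2 hne
    obtain ⟨l₀, hl⟩ : ∃ l₀ : ℝ, l₀ = (2 * M + 1) / ‖c‖ := ⟨_, rfl⟩
    have hM0 : 0 ≤ M := (norm_nonneg _).trans (hM y)
    have hl0 : 0 ≤ l₀ := by rw [hl]; positivity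
    have h1 : ‖l₀ • c‖ ≤ 2 * M := by
      have : l₀ • c = V (y + l₀ • e₀) - V y := by rw [hlin l₀]; abel
      rw [this]
      exact (norm_sub_le _ _).trans (by linarith [hM (y + l₀ • e₀), hM y])
    have h2 : ‖l₀ • c‖ = 2 * M + 1 := by
      rw [norm_smul, Real.norm_eq_abs, abs_of_nonneg hl0, hl, div_mul_cancel₀ _ hcpos.ne']
    linarith
  rw [hlin l, hc0, smul_zero, add_zero]

/-- **Stub `stub_flatStratum` of the PoloidalWindowRigidity birth skeleton** (VERBATIM signature): a profile of
the route's class, poloidal along `e₃` and flat in the direction `e₀` (`∂₀ v₂ ≡ 0` on every slice), is not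
backward-singular — every slice is invariant along `e₀` (`translate_eq_of_flat_poloidal`, fed by the slice
gradient bound (D)), and the planar Liouville theorem (N₁) for Type-I profiles gives `v ≡ 0`. -/
theorem stub_flatStratum :
    ∀ (C : ℝ) (v : ℝ → EuclideanSpace ℝ (Fin 3) → EuclideanSpace ℝ (Fin 3)),
    Literature.Analysis.FluidPDE.HasTypeITimeDecay C v →
    ContinuousOn (Function.uncurry v) (Set.Iio (0 : ℝ) ×ˢ Set.univ) →
    (∀ s t : ℝ, s < t → t < 0 → ∀ x, v t x =
      Literature.Analysis.UnboundedOperators.heatExtension (v s) (t - s) x -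
        Literature.Analysis.FluidPDE.oseenDuhamel 1 s v v t x) →
    (∀ t < 0, Literature.Analysis.FluidPDE.VectorCalculus.IsDivFree (v t)) →
    (∀ s < 0, ∀ y, ⟪Literature.Analysis.FluidPDE.curl (v s) y, EuclideanSpace.single 2 1⟫_ℝ = 0) →
    (∀ s < 0, ∀ y, fderiv ℝ (v s) y (EuclideanSpace.single 0 1) 2 = 0) →
    ¬ Literature.Analysis.FluidPDE.IsBackwardSingularPoint v 0 := by
  intro C v hrate hcont hmild hdiv hpol hflat
  have hbdd := bdd_of_hasTypeITimeDecay hrate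
  have hinv : ∀ s < 0, ∀ (y : EuclideanSpace ℝ (Fin 3)) (l : ℝ),
      v s (y + l • (EuclideanSpace.single 0 1 : EuclideanSpace ℝ (Fin 3))) = v s y := by
    intro s hs y l
    have hC3 : ContDiff ℝ 3 (v s) := (analyticOnNhd_slice hcont hbdd hmild hs).contDiff
    obtain ⟨B, hB⟩ := hbdd (-s / 2) (by linarith)
    obtain ⟨M', hM'⟩ := exists_fderiv_slice_bound hcont hbdd hmild hs
    exact translate_eq_of_flat_poloidal hC3 (hdiv s hs) (fun y => hB s (by linarith) y) hM'
      (fun y => by simpa [EuclideanSpace.inner_single_right] using hpol s hs y) (hflat s hs) y l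
  have hne : (EuclideanSpace.single 0 1 : EuclideanSpace ℝ (Fin 3)) ≠ 0 := fun h0 => by
    simpa using congrArg (fun w : EuclideanSpace ℝ (Fin 3) => w 0) h0
  exact not_backwardSingular_of_zero (eq_zero_of_translate_eq hrate hcont hmild hdiv hne hinv)

end Summit.NavierStokesRegularity.NavierStokesRegularity.Theorems.PoloidalWindowDoorPoloidalWindowRigidityFlat

end
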